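import Summits.HodgeConjecture.HodgeConjecture.Theorems.BiquadraticSecantLiftDefs
import Summits.HodgeConjecture.HodgeConjecture.Theorems.BiquadraticSecantLiftBaseChangePoly
import Literature.AlgebraicGeometry.Deligne1982.WeilTypeCMQuadratic
import Literature.AlgebraicGeometry.Deligne1982.TensorPointWeilTypeCM
import Literature.AlgebraicGeometry.HodgeTheory.WeilTypeAbelianVariety
import Literature.AlgebraicGeometry.HodgeTheory.HodgeTypeExteriorProduct
import Literature.AlgebraicGeometry.Milne1999.LefschetzCentraliserBiproducts
import HarnessLib

/-!
# BiquadraticSecantLift · X2 — `H¹(⨁_{Fin 2} A)`: the graphs `J_λ` and the eigenspaces of `η^*`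
# (part 1 of «`(⨁_{Fin 2} A, η)` is of Weil type relative to `ℚ(√-d, √m)`»)

Helper file for crux X2 `BiquadraticBaseChangeHyperbolic` (stmt-HodgeConjecture-22133) of
route-HodgeConjecture-BiquadraticSecantLift. For a complex abelian SIXFOLD `A` with `φ ≫ φ = -d` (`d ≥ 1`) of Weil type
`(3, 3)` relative to `K = ℚ(φ) = ℚ(√-d)` (the tree's `Deligne1982.IsWeilTypeCM A φ (S + d) 1 3`, equivalently van Geemen's
`HodgeTheory.IsWeilType A φ 3 d`) and `m ≥ 1` not a square, the twelvefold `B = ⨁_{Fin 2} A = A ⊗_ℤ ℤ²` with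
`η = (φ ⊕ φ) ≫ (𝟙 + ψ_m)` (`ψ_m : (x, y) ↦ (m y, x)`, `ψ_m² = m`) is of Weil type relative to the CM field
`L = ℚ(η) ≅ ℚ[T]/(R_(d,m)(T²))`, `R_(d,m)(S) = S² + 2d(1+m)S + d²(m-1)²`, with `e₀ = [F:ℚ] = 2` and `k = d_L/2 = 3`
(`isWeilTypeCM_twelvefold`): Deligne's point `B = A ⊗_K L` of the proof of Thm. 4.8 (p. 34: «`H^{1,0}_σ(A₀ ⊗ E) =
H^{1,0}(A₀) ⊗ σ` has dimension `d/2` for every `σ`»), here for the RELATIVE tensor product over `K`.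

## Proof on the carriers (`H¹ = H¹(B(ℂ); ℂ)`, Künneth in degree one `Pohlmann1968.sum_map_π_map_ι`)

* §1 the pull-backs: `ψ^* π₀^* y = m·π₁^* y`, `ψ^* π₁^* y = π₀^* y`, `(φ⊕φ)^* πⱼ^* = πⱼ^* φ^*`, `η^* w = (φ⊕φ)^*(w + ψ^* w)`;
  on the graphs `J_λ y = π₀^* y + λ·π₁^* y` (`λ = ±√m`): `ψ^* J_λ y = λ J_λ y`, `η^* J_λ y = (1+λ) J_λ(φ^* y)`, and
  `H¹(B) = J_{√m} H¹(A) ⊕ J_{-√m} H¹(A)`.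
* §2 the eigenspaces: for a root `ρ = μ(1+λ)` of `R_(d,m)(T²)` (`μ = ±i√d`, `λ = ±√m`, file `…BaseChangePoly`),
  `ker(η^* - ρ) = J_λ(ker(φ^* - μ))` (the other graph contributes nothing since `(1+λ)² ≠ (1-λ)²` and `spec φ^* = {±i√d}`).
* Hodge types: `J_λ y ∈ H^{1,0}(B) ⟺ y ∈ H^{1,0}(A)` (pull-backs along `πⱼ`, `ι₀` preserve Hodge types), so the
  multiplicity of `ρ` on `H^{1,0}(B)` is that of `μ` on `H^{1,0}(A)` (`eigenMultiplicity_etaTwo`).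
The sequel `…TwelvefoldWeilType` adds `R_(d,m)(η²) = 0`, `dim B = 12` and assembles `IsWeilTypeCM B η R_(d,m) 2 3`.

Nothing here is a case of the Hodge conjecture (HC is NOT proved; X2 is not proved by this file).

## References
[cite: Deligne1982HodgeCycles, §4 (4.4), Prop. 4.4, proof of Thm. 4.8 (a)–(b) (re-edition pp. 32–34), §5 p. 55]
[cite: MoonenZarhin1998WeilClasses, §1 (6)] [cite: HatcherAT2002, §3.2 Thm. 3.16]
-/

-- every declaration of this problem lives in `Summit.HodgeConjecture.HodgeConjecture.…` (summit = sub-problem)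
set_option linter.dupNamespace false

noncomputable section

open CategoryTheory CategoryTheory.Limits Polynomial Module
open Literature.AlgebraicTopology.SingularHomology
open Literature.AlgebraicGeometry.HodgeTheory
open Literature.AlgebraicGeometry.Motives (AbelianVariety IsSmoothProjective)
open Literature.AlgebraicGeometry.Deligne1982
open Literature.AlgebraicGeometry.Pohlmann1968 (sum_map_π_map_ι map_ι_map_π_self map_ι_map_π_ne map_biproductMap_map_π)

namespace Summit.HodgeConjecture.HodgeConjecture.BiquadraticSecantLift

variable {A : AbelianVariety ℂ} {φ : A ⟶ A} {d m : ℕ}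

/-! ## §1 Pull-backs on `H¹(⨁_{Fin 2} A)` -/

section Pullbacks

variable (A m)

/-- `ψ_m^* (π₀^* y) = m · π₁^* y` (`ψ_m ≫ π₀ = m·π₁`). -/
theorem map_psiTwo_map_π_zero (y : complexBetti A.X 1) :
    complexBetti.map (psiTwo A m).hom.hom.hom 1 (complexBetti.map (biproduct.π (fun _ : Fin 2 => A) 0).hom.hom.hom 1 y) =
      (m : ℂ) • complexBetti.map (biproduct.π (fun _ : Fin 2 => A) 1).hom.hom.hom 1 y := by
  change singularCohomology.map ℂ ℂ _ 1 (singularCohomology.map ℂ ℂ _ 1 y) = _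
  rw [abelianVarietyHom_map_map_apply, psiTwo_π_zero]
  change complexBetti.map (m • biproduct.π (fun _ : Fin 2 => A) 1).hom.hom.hom 1 y = _
  rw [complexBetti_map_nsmul_one, Nat.cast_smul_eq_nsmul]
  change ((m • complexBetti.map (biproduct.π (fun _ : Fin 2 => A) 1).hom.hom.hom 1).hom) y = _
  rw [ModuleCat.hom_nsmul, LinearMap.smul_apply]

/-- `ψ_m^* (π₁^* y) = π₀^* y` (`ψ_m ≫ π₁ = π₀`). -/
theorem map_psiTwo_map_π_one (y : complexBetti A.X 1) :
    complexBetti.map (psiTwo A m).hom.hom.hom 1 (complexBetti.map (biproduct.π (fun _ : Fin 2 => A) 1).hom.hom.hom 1 y) =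
      complexBetti.map (biproduct.π (fun _ : Fin 2 => A) 0).hom.hom.hom 1 y := by
  change singularCohomology.map ℂ ℂ _ 1 (singularCohomology.map ℂ ℂ _ 1 y) = _
  rw [abelianVarietyHom_map_map_apply, psiTwo_π_one]

variable (φ)

/-- `(φ ⊕ φ)^* (πⱼ^* y) = πⱼ^* (φ^* y)`. -/
theorem map_phiTwo_map_π (j : Fin 2) (y : complexBetti A.X 1) :
    complexBetti.map (phiTwo A φ).hom.hom.hom 1 (complexBetti.map (biproduct.π (fun _ : Fin 2 => A) j).hom.hom.hom 1 y) =
      complexBetti.map (biproduct.π (fun _ : Fin 2 => A) j).hom.hom.hom 1 (complexBetti.map φ.hom.hom.hom 1 y) :=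
  map_biproductMap_map_π (fun _ : Fin 2 => A) (fun _ => φ) j 1 y

/-- `η^* w = (φ ⊕ φ)^* (w + ψ_m^* w)` (`η = (φ ⊕ φ) ≫ (𝟙 + ψ_m)`, contravariance and additivity on `H¹`). -/
theorem map_etaTwo (w : complexBetti (twelvefold A).X 1) :
    complexBetti.map (etaTwo A φ m).hom.hom.hom 1 w =
      complexBetti.map (phiTwo A φ).hom.hom.hom 1 (w + complexBetti.map (psiTwo A m).hom.hom.hom 1 w) := by
  change singularCohomology.map ℂ ℂ _ 1 w = singularCohomology.map ℂ ℂ _ 1 _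
  rw [etaTwo, ← abelianVarietyHom_map_map_apply]
  congr 1
  change complexBetti.map ((𝟙 (twelvefold A) + psiTwo A m : twelvefold A ⟶ twelvefold A)).hom.hom.hom 1 w = _
  rw [complexBetti_map_add_one]
  change complexBetti.map (𝟙 (twelvefold A) : twelvefold A ⟶ twelvefold A).hom.hom.hom 1 w +
    complexBetti.map (psiTwo A m).hom.hom.hom 1 w = _
  rw [abelianVariety_map_id_apply]

variable {φ m}

/-- **The graphs `J_λ`**: for `λ² = m`, `ψ_m^* (π₀^* y + λ·π₁^* y) = λ · (π₀^* y + λ·π₁^* y)`. -/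
theorem map_psiTwo_graph {lam : ℂ} (hlam : lam ^ 2 = (m : ℂ)) (y : complexBetti A.X 1) :
    complexBetti.map (psiTwo A m).hom.hom.hom 1
        (complexBetti.map (biproduct.π (fun _ : Fin 2 => A) 0).hom.hom.hom 1 y +
          lam • complexBetti.map (biproduct.π (fun _ : Fin 2 => A) 1).hom.hom.hom 1 y) =
      lam • (complexBetti.map (biproduct.π (fun _ : Fin 2 => A) 0).hom.hom.hom 1 y +
          lam • complexBetti.map (biproduct.π (fun _ : Fin 2 => A) 1).hom.hom.hom 1 y) := by
  rw [map_add, map_smul, map_psiTwo_map_π_zero, map_psiTwo_map_π_one, smul_add, smul_smul, ← sq, hlam, add_comm]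

/-- **`η^* J_λ y = (1 + λ) · J_λ (φ^* y)`** for `λ² = m`. -/
theorem map_etaTwo_graph {lam : ℂ} (hlam : lam ^ 2 = (m : ℂ)) (y : complexBetti A.X 1) :
    complexBetti.map (etaTwo A φ m).hom.hom.hom 1
        (complexBetti.map (biproduct.π (fun _ : Fin 2 => A) 0).hom.hom.hom 1 y +
          lam • complexBetti.map (biproduct.π (fun _ : Fin 2 => A) 1).hom.hom.hom 1 y) =
      (1 + lam) • (complexBetti.map (biproduct.π (fun _ : Fin 2 => A) 0).hom.hom.hom 1 (complexBetti.map φ.hom.hom.hom 1 y) +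
          lam • complexBetti.map (biproduct.π (fun _ : Fin 2 => A) 1).hom.hom.hom 1 (complexBetti.map φ.hom.hom.hom 1 y)) := by
  rw [map_etaTwo, map_psiTwo_graph A hlam]
  have e : (complexBetti.map (biproduct.π (fun _ : Fin 2 => A) 0).hom.hom.hom 1 y +
        lam • complexBetti.map (biproduct.π (fun _ : Fin 2 => A) 1).hom.hom.hom 1 y) +
      lam • (complexBetti.map (biproduct.π (fun _ : Fin 2 => A) 0).hom.hom.hom 1 y +
        lam • complexBetti.map (biproduct.π (fun _ : Fin 2 => A) 1).hom.hom.hom 1 y) =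
      (1 + lam) • (complexBetti.map (biproduct.π (fun _ : Fin 2 => A) 0).hom.hom.hom 1 y +
        lam • complexBetti.map (biproduct.π (fun _ : Fin 2 => A) 1).hom.hom.hom 1 y) := by
    rw [add_smul, one_smul]
  rw [e, map_smul, map_add, map_smul, map_phiTwo_map_π, map_phiTwo_map_π]

/-- **Künneth on the graphs**: every `w ∈ H¹(⨁_{Fin 2} A)` is `J_λ a + J_{-λ} b` for `λ ≠ 0`
(`a, b = ½(ι₀^* w ± λ⁻¹ ι₁^* w)`). -/
theorem exists_graph_decomposition {lam : ℂ} (hlam0 : lam ≠ 0)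
    (w : complexBetti (twelvefold A).X 1) :
    ∃ a b : complexBetti A.X 1,
      w = (complexBetti.map (biproduct.π (fun _ : Fin 2 => A) 0).hom.hom.hom 1 a +
            lam • complexBetti.map (biproduct.π (fun _ : Fin 2 => A) 1).hom.hom.hom 1 a) +
          (complexBetti.map (biproduct.π (fun _ : Fin 2 => A) 0).hom.hom.hom 1 b +
            (-lam) • complexBetti.map (biproduct.π (fun _ : Fin 2 => A) 1).hom.hom.hom 1 b) := by
  set y := complexBetti.map (biproduct.ι (fun _ : Fin 2 => A) 0).hom.hom.hom 1 w with hy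
  set z := complexBetti.map (biproduct.ι (fun _ : Fin 2 => A) 1).hom.hom.hom 1 w with hz
  refine ⟨(2 : ℂ)⁻¹ • (y + lam⁻¹ • z), (2 : ℂ)⁻¹ • (y - lam⁻¹ • z), ?_⟩
  have hw : w = complexBetti.map (biproduct.π (fun _ : Fin 2 => A) 0).hom.hom.hom 1 y +
      complexBetti.map (biproduct.π (fun _ : Fin 2 => A) 1).hom.hom.hom 1 z := by
    rw [← sum_map_π_map_ι (fun _ : Fin 2 => A) w, Fin.sum_univ_two]
  conv_lhs => rw [hw]
  simp only [map_smul, map_add, map_sub, smul_add, smul_sub, smul_smul]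
  match_scalars <;> field_simp <;> ring

end Pullbacks

/-! ## §2 The eigenspaces of `η^*` -/

section Eigenspaces

/-- An eigenvalue `c` of `φ^*` on `H¹` with `φ ≫ φ = -d` satisfies `c² = -d` (`(φ^*)² = -d`). -/
theorem sq_eq_neg_of_eigenvector_one (hφ : φ ≫ φ = -(d • 𝟙 A)) {c : ℂ} {a : complexBetti A.X 1}
    (ha : complexBetti.map φ.hom.hom.hom 1 a = c • a) (ha0 : a ≠ 0) : c ^ 2 = -(d : ℂ) := by
  have h1 := complexBetti_map_map_one_of_comp_self hφ a
  rw [ha, map_smul, ha, smul_smul, ← sq] at h1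
  have h2 : (c ^ 2 + (d : ℂ)) • a = 0 := by rw [add_smul, h1, neg_add_cancel]
  rcases smul_eq_zero.1 h2 with h | h
  · exact eq_neg_of_add_eq_zero_left h
  · exact absurd h ha0

/-- **Eigenvectors of `η^*` for `ρ = μ(1+λ)` are graphs**: if `η^* w = μ(1+λ)·w` (`μ² = -d`, `λ² = m`, `λ ≠ 0`,
`1 + λ ≠ 0`, `1 - λ ≠ 0`, `d ≠ 0`) then `w = J_λ(ι₀^* w)` and `φ^*(ι₀^* w) = μ·ι₀^* w`. The other graph `J_{-λ}`
contributes nothing: on it `(η^*)² = -d(1-λ)² ≠ -d(1+λ)² = ρ²`. -/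
theorem eq_graph_of_eigenvector_etaTwo (hφ : φ ≫ φ = -(d • 𝟙 A)) (hd : (d : ℂ) ≠ 0) {μ lam : ℂ}
    (hμ : μ ^ 2 = -(d : ℂ)) (hlam : lam ^ 2 = (m : ℂ)) (hlam0 : lam ≠ 0) (h1l : 1 - lam ≠ 0) (h1l' : 1 + lam ≠ 0)
    {w : complexBetti (twelvefold A).X 1}
    (hw : complexBetti.map (etaTwo A φ m).hom.hom.hom 1 w = (μ * (1 + lam)) • w) :
    w = complexBetti.map (biproduct.π (fun _ : Fin 2 => A) 0).hom.hom.hom 1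
          (complexBetti.map (biproduct.ι (fun _ : Fin 2 => A) 0).hom.hom.hom 1 w) +
        lam • complexBetti.map (biproduct.π (fun _ : Fin 2 => A) 1).hom.hom.hom 1
          (complexBetti.map (biproduct.ι (fun _ : Fin 2 => A) 0).hom.hom.hom 1 w) ∧
      complexBetti.map φ.hom.hom.hom 1 (complexBetti.map (biproduct.ι (fun _ : Fin 2 => A) 0).hom.hom.hom 1 w) =
        μ • complexBetti.map (biproduct.ι (fun _ : Fin 2 => A) 0).hom.hom.hom 1 w := by
  set y := complexBetti.map (biproduct.ι (fun _ : Fin 2 => A) 0).hom.hom.hom 1 w with hy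
  set z := complexBetti.map (biproduct.ι (fun _ : Fin 2 => A) 1).hom.hom.hom 1 w with hz
  set P := complexBetti.map φ.hom.hom.hom 1 y with hP
  set Q := complexBetti.map φ.hom.hom.hom 1 z with hQ
  have hw0 : w = complexBetti.map (biproduct.π (fun _ : Fin 2 => A) 0).hom.hom.hom 1 y +
      complexBetti.map (biproduct.π (fun _ : Fin 2 => A) 1).hom.hom.hom 1 z := by
    rw [← sum_map_π_map_ι (fun _ : Fin 2 => A) w, Fin.sum_univ_two]
  -- `η^* w = π₀^* φ^*(y + z) + π₁^* φ^*(z + m y)`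
  have hη : complexBetti.map (etaTwo A φ m).hom.hom.hom 1 w =
      complexBetti.map (biproduct.π (fun _ : Fin 2 => A) 0).hom.hom.hom 1 (P + Q) +
        complexBetti.map (biproduct.π (fun _ : Fin 2 => A) 1).hom.hom.hom 1 (Q + (m : ℂ) • P) := by
    rw [map_etaTwo, hw0]
    simp only [map_add, map_smul]
    rw [map_psiTwo_map_π_zero, map_psiTwo_map_π_one, map_smul]
    repeat rw [map_phiTwo_map_π]
    rw [← hP, ← hQ]
    abel
  -- read the two components of `η^* w = ρ w`
  have hι0 : complexBetti.map (biproduct.ι (fun _ : Fin 2 => A) 0).hom.hom.hom 1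
      (complexBetti.map (etaTwo A φ m).hom.hom.hom 1 w) = P + Q := by
    rw [hη, map_add, map_ι_map_π_self, map_ι_map_π_ne _ (by decide), add_zero]
  have hι1 : complexBetti.map (biproduct.ι (fun _ : Fin 2 => A) 1).hom.hom.hom 1
      (complexBetti.map (etaTwo A φ m).hom.hom.hom 1 w) = Q + (m : ℂ) • P := by
    rw [hη, map_add, map_ι_map_π_ne _ (by decide), map_ι_map_π_self, zero_add]
  have E1 : P + Q = (μ * (1 + lam)) • y := by rw [← hι0, hw, map_smul]
  have E2 : Q + (m : ℂ) • P = (μ * (1 + lam)) • z := by rw [← hι1, hw, map_smul]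
  -- `a = z - λ y` satisfies `(1 - λ) φ^* a = ρ a`
  have ha : complexBetti.map φ.hom.hom.hom 1 (z - lam • y) = Q - lam • P := by
    rw [map_sub, map_smul]
  have hEa : (1 - lam) • complexBetti.map φ.hom.hom.hom 1 (z - lam • y) = (μ * (1 + lam)) • (z - lam • y) := by
    rw [ha]
    have e : (1 - lam) • (Q - lam • P) = (Q + (m : ℂ) • P) - lam • (P + Q) := by
      rw [← hlam]; module
    rw [e, E1, E2]
    module
  have ha0 : z - lam • y = 0 := by
    by_contra hne
    have hev : complexBetti.map φ.hom.hom.hom 1 (z - lam • y) = ((μ * (1 + lam)) / (1 - lam)) • (z - lam • y) := by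
      rw [div_eq_inv_mul, mul_smul, ← hEa, smul_smul, inv_mul_cancel₀ h1l, one_smul]
    have hsq := sq_eq_neg_of_eigenvector_one hφ hev hne
    rw [div_pow, mul_pow, hμ, div_eq_iff (pow_ne_zero 2 h1l)] at hsq
    have h4 : (d : ℂ) * (4 * lam) = 0 := by linear_combination -hsq
    rcases mul_eq_zero.1 h4 with h | h
    · exact hd h
    · exact hlam0 (by linear_combination h / 4)
  have hz : z = lam • y := sub_eq_zero.1 ha0
  refine ⟨by rw [hw0, hz, map_smul], ?_⟩
  -- `(1+λ) P = μ(1+λ) y`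
  have hQ' : Q = lam • P := by rw [hQ, hz, map_smul]
  have h3 : (1 + lam) • P = (1 + lam) • (μ • y) := by
    rw [smul_smul, mul_comm (1 + lam) μ, ← E1, hQ']; module
  exact smul_right_injective _ h1l' h3

/-- **`ker(η^* - μ(1+λ)) = J_λ(ker(φ^* - μ))`** on `H¹(⨁_{Fin 2} A)` (`J_λ = π₀^* + λ·π₁^*`). -/
theorem eigenspace_etaTwo_eq_map (hφ : φ ≫ φ = -(d • 𝟙 A)) (hd : (d : ℂ) ≠ 0) {μ lam : ℂ}
    (hμ : μ ^ 2 = -(d : ℂ)) (hlam : lam ^ 2 = (m : ℂ)) (hlam0 : lam ≠ 0) (h1l : 1 - lam ≠ 0) (h1l' : 1 + lam ≠ 0) :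
    Module.End.eigenspace (complexBetti.map (etaTwo A φ m).hom.hom.hom 1).hom (μ * (1 + lam)) =
      (Module.End.eigenspace (complexBetti.map φ.hom.hom.hom 1).hom μ).map
        ((complexBetti.map (biproduct.π (fun _ : Fin 2 => A) 0).hom.hom.hom 1).hom +
          lam • (complexBetti.map (biproduct.π (fun _ : Fin 2 => A) 1).hom.hom.hom 1).hom) := by
  ext w
  rw [Module.End.mem_eigenspace_iff, Submodule.mem_map]
  constructor
  · intro hw
    obtain ⟨hwJ, hy⟩ := eq_graph_of_eigenvector_etaTwo hφ hd hμ hlam hlam0 h1l h1l' hw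
    refine ⟨complexBetti.map (biproduct.ι (fun _ : Fin 2 => A) 0).hom.hom.hom 1 w,
      Module.End.mem_eigenspace_iff.2 hy, ?_⟩
    rw [LinearMap.add_apply, LinearMap.smul_apply]
    exact hwJ.symm
  · rintro ⟨y, hy, rfl⟩
    rw [Module.End.mem_eigenspace_iff] at hy
    rw [LinearMap.add_apply, LinearMap.smul_apply]
    change complexBetti.map (etaTwo A φ m).hom.hom.hom 1
        (complexBetti.map (biproduct.π (fun _ : Fin 2 => A) 0).hom.hom.hom 1 y +
          lam • complexBetti.map (biproduct.π (fun _ : Fin 2 => A) 1).hom.hom.hom 1 y) = _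
    rw [map_etaTwo_graph A hlam]
    change (1 + lam) • (complexBetti.map (biproduct.π (fun _ : Fin 2 => A) 0).hom.hom.hom 1
        ((complexBetti.map φ.hom.hom.hom 1).hom y) +
          lam • complexBetti.map (biproduct.π (fun _ : Fin 2 => A) 1).hom.hom.hom 1
            ((complexBetti.map φ.hom.hom.hom 1).hom y)) = _
    rw [hy, map_smul, map_smul, mul_comm μ]
    module

/-- `J_λ` is injective (`ι₀^* ∘ J_λ = id`). -/
theorem graph_injective (lam : ℂ) :
    Function.Injective ((complexBetti.map (biproduct.π (fun _ : Fin 2 => A) 0).hom.hom.hom 1).hom +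
      lam • (complexBetti.map (biproduct.π (fun _ : Fin 2 => A) 1).hom.hom.hom 1).hom) := by
  intro y y' h
  have h' := congrArg (complexBetti.map (biproduct.ι (fun _ : Fin 2 => A) 0).hom.hom.hom 1) h
  simp only [LinearMap.add_apply, LinearMap.smul_apply, map_add, map_smul] at h'
  change complexBetti.map (biproduct.ι (fun _ : Fin 2 => A) 0).hom.hom.hom 1
        (complexBetti.map (biproduct.π (fun _ : Fin 2 => A) 0).hom.hom.hom 1 y) +
      lam • complexBetti.map (biproduct.ι (fun _ : Fin 2 => A) 0).hom.hom.hom 1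
        (complexBetti.map (biproduct.π (fun _ : Fin 2 => A) 1).hom.hom.hom 1 y) =
    complexBetti.map (biproduct.ι (fun _ : Fin 2 => A) 0).hom.hom.hom 1
        (complexBetti.map (biproduct.π (fun _ : Fin 2 => A) 0).hom.hom.hom 1 y') +
      lam • complexBetti.map (biproduct.ι (fun _ : Fin 2 => A) 0).hom.hom.hom 1
        (complexBetti.map (biproduct.π (fun _ : Fin 2 => A) 1).hom.hom.hom 1 y') at h'
  rwa [map_ι_map_π_self, map_ι_map_π_self, map_ι_map_π_ne _ (by decide), map_ι_map_π_ne _ (by decide),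
    smul_zero, add_zero, add_zero] at h'

/-- **With Hodge types: `ker(η^* - μ(1+λ)) ∩ H^{1,0}(B) = J_λ(ker(φ^* - μ) ∩ H^{1,0}(A))`** (pull-backs along
`πⱼ` and `ι₀` preserve Hodge types; Deligne p. 34: «`H^{1,0}_σ(A₀ ⊗ E) = H^{1,0}(A₀) ⊗ σ`»). -/
theorem eigenspace_inf_hodgeOneZero_etaTwo_eq_map (hφ : φ ≫ φ = -(d • 𝟙 A)) (hd : (d : ℂ) ≠ 0) {μ lam : ℂ}
    (hμ : μ ^ 2 = -(d : ℂ)) (hlam : lam ^ 2 = (m : ℂ)) (hlam0 : lam ≠ 0) (h1l : 1 - lam ≠ 0) (h1l' : 1 + lam ≠ 0) :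
    Module.End.eigenspace (complexBetti.map (etaTwo A φ m).hom.hom.hom 1).hom (μ * (1 + lam)) ⊓
        hodgeOneZero (Literature.AlgebraicGeometry.Motives.AbelianVariety.isSmoothProjective_holds (A := twelvefold A)) =
      (Module.End.eigenspace (complexBetti.map φ.hom.hom.hom 1).hom μ ⊓
          hodgeOneZero (Literature.AlgebraicGeometry.Motives.AbelianVariety.isSmoothProjective_holds (A := A))).map
        ((complexBetti.map (biproduct.π (fun _ : Fin 2 => A) 0).hom.hom.hom 1).hom +
          lam • (complexBetti.map (biproduct.π (fun _ : Fin 2 => A) 1).hom.hom.hom 1).hom) := by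
  have hA : IsSmoothProjective A.dim A.X := Literature.AlgebraicGeometry.Motives.AbelianVariety.isSmoothProjective_holds
  have hB : IsSmoothProjective (twelvefold A).dim (twelvefold A).X :=
    Literature.AlgebraicGeometry.Motives.AbelianVariety.isSmoothProjective_holds
  ext w
  constructor
  · rintro ⟨hw, hwH⟩
    have hw' := Module.End.mem_eigenspace_iff.1 hw
    obtain ⟨hwJ, hy⟩ := eq_graph_of_eigenvector_etaTwo hφ hd hμ hlam hlam0 h1l h1l' hw'
    refine ⟨complexBetti.map (biproduct.ι (fun _ : Fin 2 => A) 0).hom.hom.hom 1 w, ⟨Module.End.mem_eigenspace_iff.2 hy, ?_⟩, ?_⟩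
    · rw [SetLike.mem_coe, mem_hodgeOneZero]
      exact ((mem_hodgeOneZero hB).1 hwH).map_of_isSmoothProjective hA hB _
    · rw [LinearMap.add_apply, LinearMap.smul_apply]
      exact hwJ.symm
  · rintro ⟨y, ⟨hy, hyH⟩, rfl⟩
    refine ⟨?_, ?_⟩
    · rw [eigenspace_etaTwo_eq_map hφ hd hμ hlam hlam0 h1l h1l']
      exact Submodule.mem_map_of_mem hy
    · have hyH' := (mem_hodgeOneZero hA).1 hyH
      rw [SetLike.mem_coe, mem_hodgeOneZero, LinearMap.add_apply, LinearMap.smul_apply]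
      exact IsOfHodgeType.add hB (hyH'.map_of_isSmoothProjective hB hA _) ((hyH'.map_of_isSmoothProjective hB hA _).smul _)

/-- **The multiplicity of `ρ = μ(1+λ)` on `H^{1,0}(⨁_{Fin 2} A)` is that of `μ` on `H^{1,0}(A)`.** -/
theorem eigenMultiplicity_etaTwo (hφ : φ ≫ φ = -(d • 𝟙 A)) (hd : (d : ℂ) ≠ 0) {μ lam : ℂ}
    (hμ : μ ^ 2 = -(d : ℂ)) (hlam : lam ^ 2 = (m : ℂ)) (hlam0 : lam ≠ 0) (h1l : 1 - lam ≠ 0) (h1l' : 1 + lam ≠ 0) :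
    eigenMultiplicity (twelvefold A) (etaTwo A φ m) (μ * (1 + lam)) = eigenMultiplicity A φ μ := by
  unfold eigenMultiplicity
  rw [eigenspace_inf_hodgeOneZero_etaTwo_eq_map hφ hd hμ hlam hlam0 h1l h1l']
  exact (LinearEquiv.finrank_eq (Submodule.equivMapOfInjective _ (graph_injective lam) _)).symm

end Eigenspaces

end Summit.HodgeConjecture.HodgeConjecture.BiquadraticSecantLift
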